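import Summits.QuantumFields.YangMills.Theses.SlowBitWindow
import Summits.QuantumFields.YangMills.Theses.SwapTwistDeficit
import Summits.QuantumFields.YangMills.Theorems.SlowBitWindowInsertionTraceSpectral
import HarnessLib

/-!
# `SubFemtoEntropy` (shared crux of SlowBitWindow / SwapTwistDeficit, stmt-QuantumFields-23272) from `ThermalTraceWindow.FewBodyEntropy`

The bridge the SlowBitWindow route text asks for («SubFemtoEntropy ⇐ FewBodyEntropy (22537) by a one-line bridge … file then as support
`SubFemtoEntropy_of_fewBodyEntropy`»; D-0145 LINEs g10-A/B of seat ym-idea-4):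

* `subFemtoEntropy_of_fewBodyEntropy : ThermalTraceWindow.FewBodyEntropy → SlowBitWindow.SubFemtoEntropy` — on the window `L ≤ β^A`,
  `Z(L) ≤ (1 + C β^q L^p √((λ₁/λ₀)^L)) λ₀^L ≤ (1 + C β^{q⁺} β^{A p⁺}) λ₀^L ≤ β^{q⁺ + A p⁺ + 1} λ₀^L` for `β ≥ max(β₁, 2, 1 + C)`
  (`√((λ₁/λ₀)^L) ≤ 1` because `0 < λ₁ ≤ λ₀`, `levelValue_antitone`; `q⁺ = max q 0`, `p⁺ = max p 0` absorb negative exponents);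
* `swapTwistDeficit_subFemtoEntropy_iff` — the two routes' `SubFemtoEntropy` decls are the same proposition (`Iff.rfl`);
* `swapTwistDeficit_subFemtoEntropy_of_fewBodyEntropy` — the SwapTwistDeficit twin.

So both g10 lines wait on ThermalTraceWindow's K1a `FewBodyEntropy` (22537, XL) only through this proved implication.
HONEST FRAMING: pure bookkeeping (real powers); conditional on an OPEN crux; no summit, no mass gap, nothing about infinite volume or the
continuum is proved here.
References: [cite: Luscher1983, §2]; [cite: MontvayMunster1994, (3.145)].
-/

set_option autoImplicit false

noncomputable section

open MeasureTheory Filter Topology Function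
open Literature.MathematicalPhysics.QuantumFieldTheory
open Literature.MathematicalPhysics.QuantumLattice
open Literature.Analysis.OperatorTheory.YMMatrixModel
open scoped BigOperators

namespace Summit.QuantumFields.YangMills.Theorems.SlowBitWindow

open Summit.QuantumFields.YangMills.Theorems.FemtoTransferGap
open Summit.QuantumFields.YangMills.Theorems.FemtoTransferGap.TT

/-- **`FewBodyEntropy ⇒ SubFemtoEntropy`** (K1a of ThermalTraceWindow, stmt-QuantumFields-22537, implies the shared crux 23272 of the two g10
lines): on the sub-femto window `L ≤ β^A` the few-body entropy bound `Z(L) ≤ (1 + C β^q L^p √((λ₁/λ₀)^L)) λ₀^L` gives `Z(L) ≤ β^{q'} λ₀^L` with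
`q' = max q 0 + A · max p 0 + 1`, `β ≥ max β₁ (max 2 (1 + C))`, `L ≥ 2`. [cite: Luscher1983, §2] -/
theorem subFemtoEntropy_of_fewBodyEntropy :
    Summit.QuantumFields.YangMills.Theses.ThermalTraceWindow.FewBodyEntropy →
      Summit.QuantumFields.YangMills.Theses.SlowBitWindow.SubFemtoEntropy := by
  rintro ⟨C, q, p, hC, β₁, hFBE⟩ A hA
  refine ⟨max q 0 + A * max p 0 + 1, max β₁ (max 2 (1 + C)), 2, fun β hβ L _ hL hLA => ?_⟩
  have hβ1 : β₁ ≤ β := le_trans (le_max_left _ _) hβ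
  have hβ2 : 2 ≤ β := le_trans (le_trans (le_max_left _ _) (le_max_right _ _)) hβ
  have hβC : 1 + C ≤ β := le_trans (le_trans (le_max_right _ _) (le_max_right _ _)) hβ
  have hβpos : 0 < β := by linarith
  have hβone : 1 ≤ β := by linarith
  have h := hFBE β hβ1 L hL
  -- `0 < λ₁ ≤ λ₀`
  have hl0 : 0 < levelValue su2Rep L β 0 := levelValue_su2Rep_pos hβpos 0
  have hl1 : 0 < levelValue su2Rep L β 1 := levelValue_su2Rep_pos hβpos 1
  have hl10 : levelValue su2Rep L β 1 ≤ levelValue su2Rep L β 0 :=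
    KTRCalibration.levelValue_antitone (L := L) hβpos.le (Nat.zero_le 1)
  have hsqrt : Real.sqrt ((levelValue su2Rep L β 1 / levelValue su2Rep L β 0) ^ L) ≤ 1 := by
    refine Real.sqrt_le_one.mpr ?_
    exact pow_le_one₀ (div_nonneg hl1.le hl0.le) ((div_le_one hl0).mpr hl10)
  -- the polynomial factor on the window
  have hL1 : (1 : ℝ) ≤ (L : ℝ) := by exact_mod_cast (show 1 ≤ L by omega)
  have hLpos : (0 : ℝ) ≤ (L : ℝ) := by positivity
  have hLp : (L : ℝ) ^ p ≤ β ^ (A * max p 0) := by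
    rcases le_or_gt 0 p with hp | hp
    · rw [max_eq_left hp, Real.rpow_mul hβpos.le]
      exact Real.rpow_le_rpow hLpos hLA hp
    · rw [max_eq_right hp.le, mul_zero, Real.rpow_zero]
      exact Real.rpow_le_one_of_one_le_of_nonpos hL1 hp.le
  have hβq : β ^ q ≤ β ^ (max q 0) := Real.rpow_le_rpow_of_exponent_le hβone (le_max_left _ _)
  have hprod : C * β ^ q * (L : ℝ) ^ p ≤ C * β ^ (max q 0 + A * max p 0) := by
    rw [Real.rpow_add hβpos, ← mul_assoc]
    exact mul_le_mul (mul_le_mul_of_nonneg_left hβq hC.le) hLp (Real.rpow_nonneg hLpos p)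
      (mul_nonneg hC.le (Real.rpow_nonneg hβpos.le _))
  have hs0 : 0 ≤ max q 0 + A * max p 0 := add_nonneg (le_max_right _ _) (mul_nonneg hA.le (le_max_right _ _))
  have hone : (1 : ℝ) ≤ β ^ (max q 0 + A * max p 0) := Real.one_le_rpow hβone hs0
  have hfactor : 1 + C * β ^ q * (L : ℝ) ^ p * Real.sqrt ((levelValue su2Rep L β 1 / levelValue su2Rep L β 0) ^ L) ≤
      β ^ (max q 0 + A * max p 0 + 1) := by
    have hCterm : 0 ≤ C * β ^ q * (L : ℝ) ^ p := mul_nonneg (mul_nonneg hC.le (Real.rpow_nonneg hβpos.le q)) (Real.rpow_nonneg hLpos p)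
    calc 1 + C * β ^ q * (L : ℝ) ^ p * Real.sqrt ((levelValue su2Rep L β 1 / levelValue su2Rep L β 0) ^ L)
        ≤ 1 + C * β ^ q * (L : ℝ) ^ p * 1 := by gcongr
      _ ≤ 1 + C * β ^ (max q 0 + A * max p 0) := by rw [mul_one]; linarith [hprod]
      _ ≤ (1 + C) * β ^ (max q 0 + A * max p 0) := by nlinarith [hone, hC.le]
      _ ≤ β * β ^ (max q 0 + A * max p 0) := mul_le_mul_of_nonneg_right hβC (Real.rpow_nonneg hβpos.le _)
      _ = β ^ (max q 0 + A * max p 0 + 1) := by rw [Real.rpow_add hβpos (max q 0 + A * max p 0) 1, Real.rpow_one, mul_comm]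
  calc physTrace L β L ≤ (1 + C * β ^ q * (L : ℝ) ^ p * Real.sqrt ((levelValue su2Rep L β 1 / levelValue su2Rep L β 0) ^ L)) *
        levelValue su2Rep L β 0 ^ L := h
    _ ≤ β ^ (max q 0 + A * max p 0 + 1) * levelValue su2Rep L β 0 ^ L :=
        mul_le_mul_of_nonneg_right hfactor (pow_nonneg hl0.le L)

/-- The two g10 routes' `SubFemtoEntropy` decls are the same proposition. [folklore] -/
theorem swapTwistDeficit_subFemtoEntropy_iff :
    Summit.QuantumFields.YangMills.Theses.SwapTwistDeficit.SubFemtoEntropy ↔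
      Summit.QuantumFields.YangMills.Theses.SlowBitWindow.SubFemtoEntropy := Iff.rfl

/-- **`FewBodyEntropy ⇒ SwapTwistDeficit.SubFemtoEntropy`** (the twin of `subFemtoEntropy_of_fewBodyEntropy`). [cite: Luscher1983, §2] -/
theorem swapTwistDeficit_subFemtoEntropy_of_fewBodyEntropy :
    Summit.QuantumFields.YangMills.Theses.ThermalTraceWindow.FewBodyEntropy →
      Summit.QuantumFields.YangMills.Theses.SwapTwistDeficit.SubFemtoEntropy :=
  fun h => swapTwistDeficit_subFemtoEntropy_iff.mpr (subFemtoEntropy_of_fewBodyEntropy h)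

end Summit.QuantumFields.YangMills.Theorems.SlowBitWindow

end
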